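import Mathlib
import Summits.KontsevichZagierPeriods.KontsevichZagierPeriods.Theorems.SoloInformedKappaConcat
import Summits.KontsevichZagierPeriods.KontsevichZagierPeriods.Theorems.SoloInformedNashApprox
import Summits.KontsevichZagierPeriods.KontsevichZagierPeriods.Theorems.SoloInformedHTEdges
import Summits.KontsevichZagierPeriods.KontsevichZagierPeriods.Theorems.SoloInformedCoonsCell
import HarnessLib

/-! # Part 3 — (HT), (HI) and Rung 2 -/

noncomputable section

open Literature.NumberTheory.Transcendental

namespace Summit.KontsevichZagierPeriods.KontsevichZagierPeriods.Theorems

/-- **Rung 2 ⟸ (HT) ∧ (HW).** Equal volumes of compact `ℚ`-semialgebraic planar bodies with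
non-empty interior are connected by Kontsevich–Zagier moves, granted (HT) and Huber–Wüstholz's
theorem on one-dimensional periods. -/
theorem soloInformed_volumeRung_two_of_nashHT (hT : SoloInformedNashHT)
    (hHW : HuberWustholzCurvePeriods) : SoloInformedVolumeRung 2 :=
  soloInformed_volumeRung_two_of_HT' soloInformed_nashApprox hT hHW

end Summit.KontsevichZagierPeriods.KontsevichZagierPeriods.Theorems

/-! # Part 2 — (HT): invariance of `κ̃` under concatenation up to homotopy -/


open scoped Topology unitInterval
open Set Metric MvPolynomial
open Literature.NumberTheory.Transcendental Literature.NumberTheory.Transcendental.KZ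
open Literature.NumberTheory.Transcendental.CurvePeriods
open Literature.ModelTheory.ExponentialFields

namespace Summit.KontsevichZagierPeriods.KontsevichZagierPeriods.Theorems

variable {Z : CurveData}

/-! ## 0. Cellwise relations (the Coons cell) and `κ(a) + κ(b) = κ(d)` for a setting with scales -/

/-- **Cellwise relations.**  If every edge of a grid is Nash with the right end points and the
four edges of each cell run, on `[0, 1]`, in the core of the cell's chart, every cell satisfies
`κOpt(B) + κOpt(R) − κOpt(T) − κOpt(L) = 0` (the Coons cell `soloInformed_kappaPath_coons`). -/
theorem soloInformed_grid_hcell (hZ : Z.IsSmoothAffineCurve)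
    (ω : Fin Z.n → MvPolynomial (Fin Z.n) ℂ) (hω : ∀ i, HasAlgCoeffs (ω i)) (N M : ℕ)
    (v : ℕ → ℕ → Fin Z.n → ℂ) (hor ver : ℕ → ℕ → ℝ → Fin Z.n → ℂ)
    (chart : ℕ → ℕ → SoloInformedChart Z)
    (horN : ∀ i < N, ∀ j ≤ M, SoloInformedIsNashPath (hor i j))
    (verN : ∀ i ≤ N, ∀ j < M, SoloInformedIsNashPath (ver i j))
    (hor0 : ∀ i < N, ∀ j ≤ M, hor i j 0 = v i j)
    (hor1 : ∀ i < N, ∀ j ≤ M, hor i j 1 = v (i + 1) j)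
    (ver0 : ∀ i ≤ N, ∀ j < M, ver i j 0 = v i j)
    (ver1 : ∀ i ≤ N, ∀ j < M, ver i j 1 = v i (j + 1))
    (hB : ∀ i < N, ∀ j < M, ∀ u ∈ Icc (0 : ℝ) 1, hor i j u ∈ soloInformedCore (chart i j))
    (hT : ∀ i < N, ∀ j < M, ∀ u ∈ Icc (0 : ℝ) 1, hor i (j + 1) u ∈ soloInformedCore (chart i j))
    (hL : ∀ i < N, ∀ j < M, ∀ u ∈ Icc (0 : ℝ) 1, ver i j u ∈ soloInformedCore (chart i j))
    (hR : ∀ i < N, ∀ j < M, ∀ u ∈ Icc (0 : ℝ) 1, ver (i + 1) j u ∈ soloInformedCore (chart i j)) :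
    ∀ i < N, ∀ j < M,
      soloInformedKappaOpt ω hω (hor i j) + soloInformedKappaOpt ω hω (ver (i + 1) j) -
        soloInformedKappaOpt ω hω (hor i (j + 1)) - soloInformedKappaOpt ω hω (ver i j) = 0 := by
  intro i hi j hj
  have nB := horN i hi j hj.le
  have nT := horN i hi (j + 1) hj
  have nL := verN i hi.le j hj
  have nR := verN (i + 1) hi j hj
  rw [soloInformedKappaOpt_eq ω hω nB, soloInformedKappaOpt_eq ω hω nR,
    soloInformedKappaOpt_eq ω hω nT, soloInformedKappaOpt_eq ω hω nL]
  have h := soloInformed_kappaPath_coons hZ (chart i j) ω hω nB nT nL nR (hB i hi j hj)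
    (hT i hi j hj) (hL i hi j hj) (hR i hi j hj)
    (by rw [ver0 i hi.le j hj, hor0 i hi j hj.le])
    (by rw [ver0 (i + 1) hi j hj, hor1 i hi j hj.le])
    (by rw [ver1 i hi.le j hj, hor0 i hi (j + 1) hj])
    (by rw [ver1 (i + 1) hi j hj, hor1 i hi (j + 1) hj])
  rw [h]
  abel

namespace SoloInformedHTScale

variable {S : SoloInformedHTSetting Z} (P : SoloInformedHTScale S)

include P in
/-- **(HT) for a setting with scales.** -/
theorem kappa_eq (hZ : Z.IsSmoothAffineCurve) (ω : Fin Z.n → MvPolynomial (Fin Z.n) ℂ)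
    (hω : ∀ i, HasAlgCoeffs (ω i)) :
    soloInformedKappaPath ω hω S.a S.ha + soloInformedKappaPath ω hω S.b S.hb =
      soloInformedKappaPath ω hω S.d S.hd :=
  soloInformed_HT_of_grid ω hω S.ha S.hb S.hd P.M₀_pos P.hor P.ver
    (soloInformed_grid_hcell hZ ω hω P.N P.M P.vert P.hor P.ver P.cellChart
      (fun _ hi _ hj => P.hor_nash hZ hi hj) (fun _ hi _ hj => P.ver_nash hZ hi hj)
      (fun i _ j _ => P.hor_zero i j) (fun i _ j _ => P.hor_one i j)
      (fun _ hi _ hj => P.ver_zero hi hj) (fun _ hi _ hj => P.ver_one hi hj)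
      (fun i _ j _ u _ => P.hor_mem_core_cell i j u)
      (fun i _ j _ u _ => P.hor_succ_mem_core_cell i j u)
      (fun _ hi _ hj _ hu => P.ver_mem_core_cell hi hj hu)
      (fun _ hi _ hj _ hu => P.ver_succ_mem_core_cell hi hj hu))
    (fun _ hj => P.verA hj) (fun j _ => P.verB j) (fun j _ => P.verD j)
    (fun _ hi => P.kappaOpt_hor_bot ω hω hi) (fun _ hi => P.kappaOpt_hor_top ω hω hi)

end SoloInformedHTScale

/-! ## 1. Scales exist -/

/-- **Every setting admits scales.** -/
theorem soloInformed_exists_scale (hZ : Z.IsSmoothAffineCurve) (S : SoloInformedHTSetting Z) :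
    Nonempty (SoloInformedHTScale S) := by
  have hK : IsCompact (range S.G) := isCompact_range S.hG
  have hKZ : range S.G ⊆ Z.points := by
    rintro _ ⟨u, rfl⟩
    exact S.G_mem u
  obtain ⟨ρ, hρ, hcoarse⟩ := soloInformed_exists_coreRadius hZ hK hKZ
  obtain ⟨δ₀, hδ₀, hfine⟩ :=
    soloInformed_exists_fineRadius hZ hK hKZ (r := ρ / 4) (by positivity)
  have hδ : 0 < min δ₀ ρ := lt_min hδ₀ hρ
  have hGu : UniformContinuous S.G := CompactSpace.uniformContinuous_of_continuous S.hG
  obtain ⟨η, hη, hunif⟩ := Metric.uniformContinuous_iff.1 hGu (min δ₀ ρ / 4) (by positivity)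
  obtain ⟨N, hN⟩ := exists_nat_gt (1 / η)
  have hNr : (0 : ℝ) < N := lt_trans (by positivity) hN
  have hNpos : 0 < N := by exact_mod_cast hNr
  have hmeshN : 1 / (N : ℝ) < η := by
    rw [div_lt_iff₀ hNr]
    rw [div_lt_iff₀ hη] at hN
    linarith
  have hmeshM : 1 / ((N : ℝ) + N) < η := by
    refine lt_of_le_of_lt ?_ hmeshN
    exact one_div_le_one_div_of_le hNr (by linarith)
  have hfine' : ∀ k ∈ range S.G, ∃ c : SoloInformedChart Z,
      ball k (min δ₀ ρ) ∩ Z.points ⊆ soloInformedCore c ∧ soloInformedCore c ⊆ ball k (ρ / 4) := by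
    intro k hk
    obtain ⟨c, h1, h2⟩ := hfine k hk
    exact ⟨c, fun z hz => h1 ⟨ball_subset_ball (min_le_left _ _) hz.1, hz.2⟩, h2⟩
  exact ⟨
    { ρ := ρ
      δ := min δ₀ ρ
      η := η
      N := N
      M₀ := N
      ρ_pos := hρ
      δ_pos := hδ
      δ_le := min_le_right _ _
      N_pos := hNpos
      M₀_pos := hNpos
      coarse := hcoarse
      fine := hfine'
      unif := fun u u' h => hunif h
      N_mesh := hmeshN
      M_mesh := hmeshM }⟩

/-! ## 2. Unpacking the homotopy -/

/-- **The setting of three Nash paths with `pa · pb ~ pd`.** -/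
def soloInformedHTSettingOf {a b d : CurvePath Z} (ha : SoloInformedIsNashPath a.toFun)
    (hb : SoloInformedIsNashPath b.toFun) (hd : SoloInformedIsNashPath d.toFun) {x y z : Z.points}
    {pa : Path x y} {pb : Path y z} {pd : Path x z} (hpa : ∀ t : I, a.toFun t = pa t)
    (hpb : ∀ t : I, b.toFun t = pb t) (hpd : ∀ t : I, d.toFun t = pd t)
    (F : Path.Homotopy (pa.trans pb) pd) : SoloInformedHTSetting Z where
  a := a.toFun
  b := b.toFun
  d := d.toFun
  ha := ha
  hb := hb
  hd := hd
  hab := by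
    have h1 := hpa 1
    have h0 := hpb 0
    simp only [Set.Icc.coe_one, Path.target, Set.Icc.coe_zero, Path.source] at h1 h0
    rw [h1, h0]
  G := fun u => (F u : Fin Z.n → ℂ)
  hG := continuous_subtype_val.comp F.continuous
  G_mem := fun u => (F u).2
  G_left := by
    intro t
    simp only [ContinuousMap.HomotopyWith.apply_zero, Path.coe_toContinuousMap, Path.trans_apply]
    split_ifs with h
    · rw [← hpa]
    · rw [← hpb]
  G_right := by
    intro t
    simp only [ContinuousMap.HomotopyWith.apply_one, Path.coe_toContinuousMap]
    exact (hpd t).symm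
  G_bot := by
    intro s
    simp only [Path.Homotopy.source]
  G_top := by
    intro s
    simp only [Path.Homotopy.target]

/-! ## 3. (HT) -/

/-- **(HT): `κ̃` is additive under concatenation up to homotopy.**  For Nash paths `a, b, d` on
an embedded smooth affine curve over `ℚ̄` with `a · b ~ d` rel end points (witnessed by continuous
paths agreeing with them on `[0, 1]`), `κ̃(Z, ω, a) + κ̃(Z, ω, b) = κ̃(Z, ω, d)`.
[Huber–Wüstholz 2022, §7.2 with §13.1; Kontsevich–Zagier 2001, §1.2] -/
theorem soloInformed_kappaTilde_concat (Z : CurveData) (hZ : Z.IsSmoothAffineCurve)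
    (ω : Fin Z.n → MvPolynomial (Fin Z.n) ℂ) (hω : ∀ i, HasAlgCoeffs (ω i)) (a b d : CurvePath Z)
    (ha : SoloInformedIsNashPath a.toFun) (hb : SoloInformedIsNashPath b.toFun)
    (hd : SoloInformedIsNashPath d.toFun)
    (h : ∃ (x y z : Z.points) (pa : Path x y) (pb : Path y z) (pd : Path x z),
      (∀ t : I, a.toFun t = pa t) ∧ (∀ t : I, b.toFun t = pb t) ∧ (∀ t : I, d.toFun t = pd t) ∧
        (pa.trans pb).Homotopic pd) :
    soloInformedKappaTilde ⟨Z, hZ, ω, hω, a⟩ ha + soloInformedKappaTilde ⟨Z, hZ, ω, hω, b⟩ hb =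
      soloInformedKappaTilde ⟨Z, hZ, ω, hω, d⟩ hd := by
  obtain ⟨x, y, z, pa, pb, pd, hpa, hpb, hpd, ⟨F⟩⟩ := h
  obtain ⟨P⟩ := soloInformed_exists_scale hZ (soloInformedHTSettingOf ha hb hd hpa hpb hpd F)
  rw [soloInformedKappaTilde_eq_kappaPath, soloInformedKappaTilde_eq_kappaPath,
    soloInformedKappaTilde_eq_kappaPath]
  exact P.kappa_eq hZ ω hω

end Summit.KontsevichZagierPeriods.KontsevichZagierPeriods.Theorems

/-!
# SoloInformed — Rung 2 of the volume ladder from the Huber–Wüstholz theorem alone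

Capstone of the solo-informed programme on the conjunct `SoloInformedVolumeRung 2` of
`KontsevichZagierPeriods ↔ ∀ d, SoloInformedVolumeRung d` (`soloInformed_KZ_iff_volumeLadder`).

* `soloInformed_nashHT : SoloInformedNashHT` — the (HT) hypothesis (invariance of `κ̃` under
  concatenation up to homotopy for Nash paths), proved by the Stokes grid of Coons cells
  (`soloInformed_kappaTilde_concat`, files I1–I4);
* `soloInformed_volumeRung_two : HuberWustholzCurvePeriods → SoloInformedVolumeRung 2` — every
  `ℚ̄`-linear relation among one-dimensional periods (periods of curve type, equivalently — by
  Huber–Wüstholz Cor. 12.7 — all periods of `1`-motives) is generated by the three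
  Kontsevich–Zagier rules inside the effective period algebra, *assuming only* the published
  Huber–Wüstholz theorem (the named Literature fact `HuberWustholzCurvePeriods`).

References: Huber–Wüstholz, *Transcendence and linear relations of 1-periods* (2022), Thm. 13.3,
Cor. 12.7, §7.2; Kontsevich–Zagier, *Periods* (2001), §1.2, Question 1; Ayoub, *Une version
relative de la conjecture des périodes de Kontsevich–Zagier* (2014).
-/


open Literature.NumberTheory.Transcendental Literature.NumberTheory.Transcendental.KZ
open Literature.NumberTheory.Transcendental.CurvePeriods

namespace Summit.KontsevichZagierPeriods.KontsevichZagierPeriods.Theorems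

/-- **(HT) holds**: `κ̃` is additive under concatenation up to homotopy, for Nash paths on
embedded smooth affine curves over `ℚ̄`. [Huber–Wüstholz 2022, §7.2 with §13.1] -/
theorem soloInformed_nashHT : SoloInformedNashHT :=
  fun Z hZ ω hω a b d ha hb hd h => soloInformed_kappaTilde_concat Z hZ ω hω a b d ha hb hd h

/-- **(HI) holds**: `κ̃` is a homotopy invariant of Nash paths. -/
theorem soloInformed_nashHI : SoloInformedNashHI := soloInformed_nashHI_of_HT soloInformed_nashHT

/-- **Rung 2 of the volume ladder from Huber–Wüstholz.**  Assuming the Huber–Wüstholz theorem on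
linear relations of one-dimensional periods (a named Literature fact), two compact
`ℚ`-semialgebraic planar regions with non-empty interior and equal area have
Kontsevich–Zagier-equivalent volume representations: `SoloInformedVolumeRung 2`.
[Huber–Wüstholz 2022, Thm. 13.3; Kontsevich–Zagier 2001, §1.2] -/
theorem soloInformed_volumeRung_two (hHW : HuberWustholzCurvePeriods) : SoloInformedVolumeRung 2 :=
  soloInformed_volumeRung_two_of_nashHT soloInformed_nashHT hHW

/-- **Rungs `≤ 2` from Huber–Wüstholz** (the ladder is monotone, `soloInformedVolumeRung_of_le`):
lengths (`d = 1`) and areas (`d = 2`). -/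
theorem soloInformed_volumeRung_le_two (hHW : HuberWustholzCurvePeriods) {d : ℕ} (hd : d ≤ 2) :
    SoloInformedVolumeRung d :=
  soloInformedVolumeRung_of_le hd (soloInformed_volumeRung_two hHW)

end Summit.KontsevichZagierPeriods.KontsevichZagierPeriods.Theorems
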